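import Mathlib
import HarnessLib
import Literature.MathematicalPhysics.QuantumLattice.HubbardBandSectorCountingCounts
import Summits.HubbardSuperconductivity.HubbardSuperconductivity.Theorems.KLProgrammeH10TwoPointLimitPerturbedCountLipschitz

/-!
# Route `KLProgramme` — crux K1 `H10TwoPointLimit` (stmt-HubbardSuperconductivity-19938):
# the grid counts ON THE PERTURBED CURVE, II — the fold ranges and the anti-diagonal fibres

Port step (4b) of HOME/prover-p4/PORT-NOTE.md §6: the lineage's `KLProgrammeCountPairsOffsetFold.lean` (first half) for the perturbed level
function `h^E` of `KLProgrammePerturbedCountDefs.lean`: the fold ranges `0 < k w ≤ τ` / `k w ≥ 2π - τ` injected into anti-diagonal counts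
(`count_even_posE`, `count_even_negE`; the sum of the two perturbed partials `∂₂h^E + ∂₃h^E = h3E(θ₃,θ₂) + h3E(θ₂,θ₃)` plays the role of the
tree's `G`), the key bound of the anti-diagonal fibre with the TRUE `t`-derivative of `h^E` (`anti_key_perturbed` = `even_key_perturbed` at the
shifted level `μ' = μ - δ(S)` of the momentum sum), and the count along one anti-diagonal (`count_anti_sigmaE`, lemma L5 with the Lipschitz
constants `M_anti`, `M_Γ` of `…PerturbedCountLipschitz.lean`). Constants expanded as in `…PerturbedCountCooper/Fold/Lipschitz.lean`.
Everything is PROVED; no definitions. References: BGM 2006 Lemma 3.1 / App. A2 [cite: BenfattoGiulianiMastropietro2006].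
-/

noncomputable section

namespace Summit.HubbardSuperconductivity.HubbardSuperconductivity.Theorems.PerturbedFermiCurve

set_option linter.dupNamespace false -- summit = problem name (single-conjunct summit), D-0017

open Real Set
open Literature.MathematicalPhysics.QuantumLattice Literature.MathematicalPhysics.QuantumLattice.BandSectorCounting

section FoldCounts

variable {a b : ℝ} (B : BandBounds a b) {δ : (Fin 2 → ℝ) → ℝ} (hδs : ContDiff ℝ 2 δ)
  {κ₀ κ₁ κ₂ μ : ℝ} (hδ : ∀ k : Fin 2 → ℝ, |δ k| ≤ κ₀) (hlo : a ≤ μ - κ₀) (hhi : μ + κ₀ ≤ b)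
  (hκ : ∀ k : Fin 2 → ℝ, ‖fderiv ℝ δ k‖ ≤ κ₁) (hκ₁ : κ₁ < B.Dtmin) (hκ₂ : ∀ k : Fin 2 → ℝ, ‖fderiv ℝ (fderiv ℝ δ) k‖ ≤ κ₂)
  {u : ℝ → ℝ} (hu : ∀ θ, IsBandFermiRadius (μ - δ (u θ • dir θ)) θ (u θ))
include B hδs hδ hlo hhi hκ hκ₁ hκ₂ hu


/-! ## The fold ranges `k w ≤ τ` and `k w ≥ 2π - τ` -/

omit B hδs hδ hlo hhi hκ hκ₁ hκ₂ hu in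
/-- **The fold range `0 < k w ≤ τ` injects into the anti-diagonal counts**: `(a, k) ↦ (s, i) = (2a + k, k - 1)`, `σ_s = w/2 + s w/2`,
`t = (i + 1) w`. [folklore] -/
theorem count_even_posE {P : ℝ × ℝ} {w δ' lam τ : ℝ} (hw : 0 < w) {N : ℕ} :
    ∑ k ∈ (Finset.range N).filter (fun k : ℕ => (k : ℝ) * w ≤ τ), ((((Finset.range N).filter fun i : ℕ =>
        |hfunE δ u μ P (w / 2 + i * w) (w / 2 + i * w + k * w)| ≤ δ' ∧
        |h3E δ u P (w / 2 + i * w) (w / 2 + i * w + k * w)| < lam ∧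
        |h3E δ u P (w / 2 + i * w + k * w) (w / 2 + i * w)| < lam).card : ℝ)) ≤
      N + ∑ s ∈ Finset.range (4 * N), ((((Finset.range ⌊τ / w⌋₊).filter fun i : ℕ =>
        |hfunE δ u μ P (w / 2 + s * (w / 2) - (w + i * w) / 2) (w / 2 + s * (w / 2) + (w + i * w) / 2)| ≤ δ' ∧
        |h3E δ u P (w / 2 + s * (w / 2) + (w + i * w) / 2) (w / 2 + s * (w / 2) - (w + i * w) / 2) +
          h3E δ u P (w / 2 + s * (w / 2) - (w + i * w) / 2) (w / 2 + s * (w / 2) + (w + i * w) / 2)| ≤ 2 * lam).card : ℝ)) := by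
  set S := (Finset.range N).filter (fun k : ℕ => (k : ℝ) * w ≤ τ) with hS
  set f : ℕ → ℝ := fun k => ((((Finset.range N).filter fun i : ℕ =>
        |hfunE δ u μ P (w / 2 + i * w) (w / 2 + i * w + k * w)| ≤ δ' ∧
        |h3E δ u P (w / 2 + i * w) (w / 2 + i * w + k * w)| < lam ∧
        |h3E δ u P (w / 2 + i * w + k * w) (w / 2 + i * w)| < lam).card : ℝ)) with hf
  have hfN : ∀ k, f k ≤ N := by
    intro k
    rw [hf]; dsimp only
    have := Finset.card_filter_le (Finset.range N) (fun i : ℕ =>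
        |hfunE δ u μ P (w / 2 + i * w) (w / 2 + i * w + k * w)| ≤ δ' ∧
        |h3E δ u P (w / 2 + i * w) (w / 2 + i * w + k * w)| < lam ∧
        |h3E δ u P (w / 2 + i * w + k * w) (w / 2 + i * w)| < lam)
    rw [Finset.card_range] at this
    exact_mod_cast this
  have hf0 : ∀ k, 0 ≤ f k := fun k => by positivity
  rw [← Finset.sum_filter_add_sum_filter_not S (fun k : ℕ => k = 0)]
  have h0 : ∑ k ∈ S.filter (fun k : ℕ => k = 0), f k ≤ N := by
    have hsub : S.filter (fun k : ℕ => k = 0) ⊆ {0} := by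
      intro k hk; rw [Finset.mem_filter] at hk; rw [Finset.mem_singleton]; exact hk.2
    calc ∑ k ∈ S.filter (fun k : ℕ => k = 0), f k ≤ ∑ k ∈ ({0} : Finset ℕ), f k :=
          Finset.sum_le_sum_of_subset_of_nonneg hsub fun k _ _ => hf0 k
      _ = f 0 := Finset.sum_singleton _ _
      _ ≤ N := hfN 0
  have hpos : ∑ k ∈ S.filter (fun k : ℕ => ¬ k = 0), f k ≤
      ∑ s ∈ Finset.range (4 * N), ((((Finset.range ⌊τ / w⌋₊).filter fun i : ℕ =>
        |hfunE δ u μ P (w / 2 + s * (w / 2) - (w + i * w) / 2) (w / 2 + s * (w / 2) + (w + i * w) / 2)| ≤ δ' ∧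
        |h3E δ u P (w / 2 + s * (w / 2) + (w + i * w) / 2) (w / 2 + s * (w / 2) - (w + i * w) / 2) +
          h3E δ u P (w / 2 + s * (w / 2) - (w + i * w) / 2) (w / 2 + s * (w / 2) + (w + i * w) / 2)| ≤ 2 * lam).card : ℝ)) := by
    rw [hf]
    rw [← card_filter_product_eq_sum_snd (Finset.range N) (S.filter (fun k : ℕ => ¬ k = 0)) (fun i k =>
        |hfunE δ u μ P (w / 2 + i * w) (w / 2 + i * w + k * w)| ≤ δ' ∧
        |h3E δ u P (w / 2 + i * w) (w / 2 + i * w + k * w)| < lam ∧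
        |h3E δ u P (w / 2 + i * w + k * w) (w / 2 + i * w)| < lam),
      ← card_filter_product_eq_sum_fst (Finset.range (4 * N)) (Finset.range ⌊τ / w⌋₊) (fun s i =>
        |hfunE δ u μ P (w / 2 + s * (w / 2) - (w + i * w) / 2) (w / 2 + s * (w / 2) + (w + i * w) / 2)| ≤ δ' ∧
        |h3E δ u P (w / 2 + s * (w / 2) + (w + i * w) / 2) (w / 2 + s * (w / 2) - (w + i * w) / 2) +
          h3E δ u P (w / 2 + s * (w / 2) - (w + i * w) / 2) (w / 2 + s * (w / 2) + (w + i * w) / 2)| ≤ 2 * lam)]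
    norm_cast
    refine Finset.card_le_card_of_injOn (fun p : ℕ × ℕ => (2 * p.1 + p.2, p.2 - 1)) ?_ ?_
    · intro p hp
      rw [Finset.mem_coe, Finset.mem_filter, Finset.mem_product, Finset.mem_range, Finset.mem_filter, hS,
        Finset.mem_filter, Finset.mem_range] at hp
      obtain ⟨⟨ha, ⟨hkN, hkτ⟩, hk0⟩, hQ⟩ := hp
      have hk1 : 1 ≤ p.2 := Nat.one_le_iff_ne_zero.2 hk0
      rw [Finset.mem_coe, Finset.mem_filter, Finset.mem_product, Finset.mem_range, Finset.mem_range]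
      dsimp only
      refine ⟨⟨by omega, ?_⟩, ?_⟩
      · have : p.2 ≤ ⌊τ / w⌋₊ := by
          rw [Nat.le_floor_iff (by
            have : (0:ℝ) ≤ p.2 * w := by positivity
            exact div_nonneg (this.trans hkτ) hw.le)]
          rw [le_div_iff₀ hw]; exact hkτ
        omega
      · have e1 : w / 2 + ((2 * p.1 + p.2 : ℕ) : ℝ) * (w / 2) - (w + ((p.2 - 1 : ℕ) : ℝ) * w) / 2 = w / 2 + p.1 * w := by
          rw [Nat.cast_sub hk1]; push_cast; ring
        have e2 : w / 2 + ((2 * p.1 + p.2 : ℕ) : ℝ) * (w / 2) + (w + ((p.2 - 1 : ℕ) : ℝ) * w) / 2 =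
            w / 2 + p.1 * w + p.2 * w := by
          rw [Nat.cast_sub hk1]; push_cast; ring
        rw [e1, e2]
        refine ⟨hQ.1, ?_⟩
        calc _ ≤ |h3E δ u P (w / 2 + p.1 * w + p.2 * w) (w / 2 + p.1 * w)| + |h3E δ u P (w / 2 + p.1 * w) (w / 2 + p.1 * w + p.2 * w)| :=
              abs_add_le _ _
          _ ≤ 2 * lam := by linarith [hQ.2.1, hQ.2.2]
    · intro p hp q hq hpq
      rw [Finset.mem_coe, Finset.mem_filter, Finset.mem_product, Finset.mem_filter, hS, Finset.mem_filter] at hp hq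
      simp only [Prod.mk.injEq] at hpq
      have hp1 : 1 ≤ p.2 := Nat.one_le_iff_ne_zero.2 hp.1.2.2
      have hq1 : 1 ≤ q.2 := Nat.one_le_iff_ne_zero.2 hq.1.2.2
      have h2 : p.2 = q.2 := by omega
      have h1 : p.1 = q.1 := by omega
      exact Prod.ext h1 h2
  linarith

omit hκ₂ in
/-- **The fold range `k w ≥ 2π - τ` injects into the anti-diagonal counts**: `(a, k) ↦ (s, i) = (2a + N + k, N - k - 1)` (periodicity of
`h^E`, `∂₃h^E`). [folklore] -/
theorem count_even_negE {P : ℝ × ℝ} {w δ' lam τ : ℝ} (hw : 0 < w) {N : ℕ} (hN : (N : ℝ) * w = 2 * π) :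
    ∑ k ∈ (Finset.range N).filter (fun k : ℕ => 2 * π - τ ≤ (k : ℝ) * w), ((((Finset.range N).filter fun i : ℕ =>
        |hfunE δ u μ P (w / 2 + i * w) (w / 2 + i * w + k * w)| ≤ δ' ∧
        |h3E δ u P (w / 2 + i * w) (w / 2 + i * w + k * w)| < lam ∧
        |h3E δ u P (w / 2 + i * w + k * w) (w / 2 + i * w)| < lam).card : ℝ)) ≤
      ∑ s ∈ Finset.range (4 * N), ((((Finset.range ⌊τ / w⌋₊).filter fun i : ℕ =>
        |hfunE δ u μ P (w / 2 + s * (w / 2) - (w + i * w) / 2) (w / 2 + s * (w / 2) + (w + i * w) / 2)| ≤ δ' ∧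
        |h3E δ u P (w / 2 + s * (w / 2) + (w + i * w) / 2) (w / 2 + s * (w / 2) - (w + i * w) / 2) +
          h3E δ u P (w / 2 + s * (w / 2) - (w + i * w) / 2) (w / 2 + s * (w / 2) + (w + i * w) / 2)| ≤ 2 * lam).card : ℝ)) := by
  set S := (Finset.range N).filter (fun k : ℕ => 2 * π - τ ≤ (k : ℝ) * w) with hS
  rw [← card_filter_product_eq_sum_snd (Finset.range N) S (fun i k =>
        |hfunE δ u μ P (w / 2 + i * w) (w / 2 + i * w + k * w)| ≤ δ' ∧
        |h3E δ u P (w / 2 + i * w) (w / 2 + i * w + k * w)| < lam ∧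
        |h3E δ u P (w / 2 + i * w + k * w) (w / 2 + i * w)| < lam),
    ← card_filter_product_eq_sum_fst (Finset.range (4 * N)) (Finset.range ⌊τ / w⌋₊) (fun s i =>
        |hfunE δ u μ P (w / 2 + s * (w / 2) - (w + i * w) / 2) (w / 2 + s * (w / 2) + (w + i * w) / 2)| ≤ δ' ∧
        |h3E δ u P (w / 2 + s * (w / 2) + (w + i * w) / 2) (w / 2 + s * (w / 2) - (w + i * w) / 2) +
          h3E δ u P (w / 2 + s * (w / 2) - (w + i * w) / 2) (w / 2 + s * (w / 2) + (w + i * w) / 2)| ≤ 2 * lam)]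
  norm_cast
  refine Finset.card_le_card_of_injOn (fun p : ℕ × ℕ => (2 * p.1 + N + p.2, N - p.2 - 1)) ?_ ?_
  · intro p hp
    rw [Finset.mem_coe, Finset.mem_filter, Finset.mem_product, Finset.mem_range, hS, Finset.mem_filter,
      Finset.mem_range] at hp
    obtain ⟨⟨ha, ⟨hkN, hkτ⟩⟩, hQ⟩ := hp
    rw [Finset.mem_coe, Finset.mem_filter, Finset.mem_product, Finset.mem_range, Finset.mem_range]
    dsimp only
    have hk1 : p.2 + 1 ≤ N := hkN
    refine ⟨⟨by omega, ?_⟩, ?_⟩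
    · have hle : ((N - p.2 : ℕ) : ℝ) * w ≤ τ := by
        rw [Nat.cast_sub hkN.le, sub_mul, hN]; linarith
      have : N - p.2 ≤ ⌊τ / w⌋₊ := by
        rw [Nat.le_floor_iff (div_nonneg ((by positivity : (0:ℝ) ≤ ((N - p.2 : ℕ) : ℝ) * w).trans hle) hw.le),
          le_div_iff₀ hw]
        exact hle
      omega
    · have ec : ((N - p.2 - 1 : ℕ) : ℝ) = (N : ℝ) - p.2 - 1 := by
        rw [Nat.cast_sub (by omega : 1 ≤ N - p.2), Nat.cast_sub hkN.le]; push_cast; ring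
      have e1 : w / 2 + ((2 * p.1 + N + p.2 : ℕ) : ℝ) * (w / 2) - (w + ((N - p.2 - 1 : ℕ) : ℝ) * w) / 2 =
          w / 2 + p.1 * w + p.2 * w := by
        rw [ec]; push_cast; ring
      have e2 : w / 2 + ((2 * p.1 + N + p.2 : ℕ) : ℝ) * (w / 2) + (w + ((N - p.2 - 1 : ℕ) : ℝ) * w) / 2 =
          w / 2 + p.1 * w + (1 : ℤ) * (2 * π) := by
        rw [ec]; push_cast; rw [← hN]; ring
      rw [e1, e2, hfunE_add_int_mul_two_pi_three B hδs hδ hlo hhi hκ hκ₁ hu, hfunE_swap,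
        h3E_add_int_mul_two_pi_two B hδs hδ hlo hhi hκ hκ₁ hu, h3E_add_int_mul_two_pi_three B hδs hδ hlo hhi hκ hκ₁ hu]
      refine ⟨hQ.1, ?_⟩
      calc _ ≤ |h3E δ u P (w / 2 + p.1 * w) (w / 2 + p.1 * w + p.2 * w)| + |h3E δ u P (w / 2 + p.1 * w + p.2 * w) (w / 2 + p.1 * w)| :=
            abs_add_le _ _
        _ ≤ 2 * lam := by linarith [hQ.2.1, hQ.2.2]
  · intro p hp q hq hpq
    rw [Finset.mem_coe, Finset.mem_filter, Finset.mem_product, Finset.mem_range, hS, Finset.mem_filter,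
      Finset.mem_range] at hp hq
    simp only [Prod.mk.injEq] at hpq
    have hp1 := hp.1.2.1; have hq1 := hq.1.2.1
    have h2 : p.2 = q.2 := by omega
    have h1 : p.1 = q.1 := by omega
    exact Prod.ext h1 h2

/-! ## The anti-diagonal fibres (lemma L5 with `even_key_perturbed`) -/

/-- **The key bound of an anti-diagonal fibre with the TRUE `t`-derivative of `h^E`**: if `|h^E(σ - t/2, σ + t/2)| ≤ η₀` and the sum of the
two perturbed partials there is `≤ 4λ`, then `|(d/dt) h^E(σ - t/2, σ + t/2)| ≥ (h_min/2) t` (`even_key_perturbed` at the shifted level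
`μ' = μ - δ(S)` of the momentum sum `S`). [cite: BenfattoGiulianiMastropietro2006, App. A2] -/
theorem anti_key_perturbed {P : ℝ × ℝ} {σ t τ η₀ lam : ℝ} (ht0 : 0 < t) (htτ : t ≤ τ) (hlo' : a ≤ μ - κ₀ - η₀) (hhi' : μ + κ₀ + η₀ ≤ b)
    (hF : |hfunE δ u μ P (σ - t / 2) (σ + t / 2)| ≤ η₀)
    (hG : |h3E δ u P (σ + t / 2) (σ - t / 2) + h3E δ u P (σ - t / 2) (σ + t / 2)| ≤ 4 * lam)
    (hsmall :
      4 * (κ₁ * (π * Real.sqrt 2 + 2 * B.smax) / (B.Dtmin - κ₁)) * ((B.smax + κ₁ * (π * Real.sqrt 2 + 2 * B.smax) / (B.Dtmin - κ₁)) + B.smax) +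
          (κ₂ * (B.smax + κ₁ * (π * Real.sqrt 2 + 2 * B.smax) / (B.Dtmin - κ₁)) ^ 2 + κ₁ * ((((4 + κ₂) * (B.smax + κ₁ * (π * Real.sqrt 2 + 2 * B.smax) / (B.Dtmin - κ₁)) ^ 2 + (8 + 2 * κ₁) * ((4 + κ₁) * (π * Real.sqrt 2) / (B.Dtmin - κ₁)) + (4 + κ₁) * (π * Real.sqrt 2)) / (B.Dtmin - κ₁)) + 2 * ((4 + κ₁) * (π * Real.sqrt 2) / (B.Dtmin - κ₁)) + π * Real.sqrt 2)) / 2 +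
        2 * ((((4 + κ₂) * (B.smax + κ₁ * (π * Real.sqrt 2 + 2 * B.smax) / (B.Dtmin - κ₁)) ^ 2 + (8 + 2 * κ₁) * ((4 + κ₁) * (π * Real.sqrt 2) / (B.Dtmin - κ₁)) + (4 + κ₁) * (π * Real.sqrt 2)) / (B.Dtmin - κ₁)) + 2 * ((4 + κ₁) * (π * Real.sqrt 2) / (B.Dtmin - κ₁)) + π * Real.sqrt 2) *
          (η₀ / B.Dtmin + 2 * κ₀ / B.Dtmin + B.smax * (B.Cg * ((2 * lam + (4 + κ₁) * ((((4 + κ₂) * (B.smax + κ₁ * (π * Real.sqrt 2 + 2 * B.smax) / (B.Dtmin - κ₁)) ^ 2 + (8 + 2 * κ₁) * ((4 + κ₁) * (π * Real.sqrt 2) / (B.Dtmin - κ₁)) + (4 + κ₁) * (π * Real.sqrt 2)) / (B.Dtmin - κ₁)) + 2 * ((4 + κ₁) * (π * Real.sqrt 2) / (B.Dtmin - κ₁)) + π * Real.sqrt 2) * τ / 2) / 2 + κ₁ * (B.smax + κ₁ * (π * Real.sqrt 2 + 2 * B.smax) / (B.Dtmin - κ₁)) / 2 + 2 * (κ₁ *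 (π * Real.sqrt 2 + 2 * B.smax) / (B.Dtmin - κ₁)) + 2 * B.smax * (η₀ / B.Dtmin) + 2 * B.smax * (2 * κ₀ / B.Dtmin)) + τ / 2)) +
        κ₁ * ((((4 + κ₂) * (B.smax + κ₁ * (π * Real.sqrt 2 + 2 * B.smax) / (B.Dtmin - κ₁)) ^ 2 + (8 + 2 * κ₁) * ((4 + κ₁) * (π * Real.sqrt 2) / (B.Dtmin - κ₁)) + (4 + κ₁) * (π * Real.sqrt 2)) / (B.Dtmin - κ₁)) + 2 * ((4 + κ₁) * (π * Real.sqrt 2) / (B.Dtmin - κ₁)) + π * Real.sqrt 2) / 2 ≤ B.hmin / 2) :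
    B.hmin / 2 * t ≤ |Real.sin (SXE u P (σ - t / 2) (σ + t / 2)) * (VXE u (σ + t / 2) - VXE u (σ - t / 2)) +
        Real.sin (SYE u P (σ - t / 2) (σ + t / 2)) * (VYE u (σ + t / 2) - VYE u (σ - t / 2)) +
        fderiv ℝ δ (momE u P (σ - t / 2) (σ + t / 2))
          ![(VXE u (σ + t / 2) - VXE u (σ - t / 2)) / 2, (VYE u (σ + t / 2) - VYE u (σ - t / 2)) / 2]| := by
  set S := momE u P (σ - t / 2) (σ + t / 2) with hS
  set μ' := μ - δ S with hμ'def
  have hz := abs_le.1 (hδ S)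
  have hη₀ : 0 ≤ η₀ := (abs_nonneg _).trans hF
  have hμ' : μ' ∈ Icc a b := ⟨by linarith [hz.2], by linarith [hz.1]⟩
  have hh' : |eps2 (SXE u P (σ - t / 2) (σ + t / 2)) (SYE u P (σ - t / 2) (σ + t / 2)) - μ'| ≤ η₀ := by
    have : eps2 (SXE u P (σ - t / 2) (σ + t / 2)) (SYE u P (σ - t / 2) (σ + t / 2)) - μ' = hfunE δ u μ P (σ - t / 2) (σ + t / 2) := by
      rw [hμ'def, hS, hfunE]; ring
    rw [this]; exact hF
  have hgap : ∀ θ, |μ' - (μ - δ (u θ • dir θ))| ≤ 2 * κ₀ := by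
    intro θ
    have h1 := abs_le.1 (hδ (u θ • dir θ))
    rw [hμ'def, abs_le]; constructor <;> linarith [hz.1, hz.2]
  have e : h3E δ u P (σ + t / 2) (σ - t / 2) + h3E δ u P (σ - t / 2) (σ + t / 2) =
      (2 * Real.sin (SXE u P (σ - t / 2) (σ + t / 2)) * VXE u (σ - t / 2) + 2 * Real.sin (SYE u P (σ - t / 2) (σ + t / 2)) * VYE u (σ - t / 2) +
          fderiv ℝ δ S ![VXE u (σ - t / 2), VYE u (σ - t / 2)]) +
        (2 * Real.sin (SXE u P (σ - t / 2) (σ + t / 2)) * VXE u (σ + t / 2) + 2 * Real.sin (SYE u P (σ - t / 2) (σ + t / 2)) * VYE u (σ + t / 2) +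
          fderiv ℝ δ S ![VXE u (σ + t / 2), VYE u (σ + t / 2)]) := by
    rw [hS]; unfold h3E
    rw [SXE_swap u P (σ + t / 2) (σ - t / 2), SYE_swap u P (σ + t / 2) (σ - t / 2), momE_swap u P (σ + t / 2) (σ - t / 2)]
  rw [e] at hG
  exact even_key_perturbed B hδs hδ hlo hhi hκ hκ₁ hκ₂ hu ht0 htτ hμ' (by linarith [hz.2]) (by linarith [hz.1]) hh' hgap hG hsmall

/-- **The count along one anti-diagonal of the perturbed level function** `(σ - t/2, σ + t/2)`, `t = (i+1) w ≤ τ` (lemma L5 with the key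
bound `anti_key_perturbed`, `|F'| ≤ M_anti|t|`, `G` `M_Γ`-Lipschitz). [cite: BenfattoGiulianiMastropietro2006, Lemma 3.1] -/
theorem count_anti_sigmaE {P : ℝ × ℝ} {w δ' lam τ η₀ σ : ℝ} (hw : 0 < w) (hδ'0 : 0 ≤ δ') (hlam : 0 < lam) (hτ : 0 < τ)
    (hη₀ : 0 < η₀) (hδη : δ' ≤ η₀ / 2) (hlo' : a ≤ μ - κ₀ - η₀) (hhi' : μ + κ₀ + η₀ ≤ b)
    (hsmall :
      4 * (κ₁ * (π * Real.sqrt 2 + 2 * B.smax) / (B.Dtmin - κ₁)) * ((B.smax + κ₁ * (π * Real.sqrt 2 + 2 * B.smax) / (B.Dtmin - κ₁)) + B.smax) +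
          (κ₂ * (B.smax + κ₁ * (π * Real.sqrt 2 + 2 * B.smax) / (B.Dtmin - κ₁)) ^ 2 + κ₁ * ((((4 + κ₂) * (B.smax + κ₁ * (π * Real.sqrt 2 + 2 * B.smax) / (B.Dtmin - κ₁)) ^ 2 + (8 + 2 * κ₁) * ((4 + κ₁) * (π * Real.sqrt 2) / (B.Dtmin - κ₁)) + (4 + κ₁) * (π * Real.sqrt 2)) / (B.Dtmin - κ₁)) + 2 * ((4 + κ₁) * (π * Real.sqrt 2) / (B.Dtmin - κ₁)) + π * Real.sqrt 2)) / 2 +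
        2 * ((((4 + κ₂) * (B.smax + κ₁ * (π * Real.sqrt 2 + 2 * B.smax) / (B.Dtmin - κ₁)) ^ 2 + (8 + 2 * κ₁) * ((4 + κ₁) * (π * Real.sqrt 2) / (B.Dtmin - κ₁)) + (4 + κ₁) * (π * Real.sqrt 2)) / (B.Dtmin - κ₁)) + 2 * ((4 + κ₁) * (π * Real.sqrt 2) / (B.Dtmin - κ₁)) + π * Real.sqrt 2) *
          (η₀ / B.Dtmin + 2 * κ₀ / B.Dtmin + B.smax * (B.Cg * ((2 * lam + (4 + κ₁) * ((((4 + κ₂) * (B.smax + κ₁ * (π * Real.sqrt 2 + 2 * B.smax) / (B.Dtmin - κ₁)) ^ 2 + (8 + 2 * κ₁) * ((4 + κ₁) * (π * Real.sqrt 2) / (B.Dtmin - κ₁)) + (4 + κ₁) * (π * Real.sqrt 2)) / (B.Dtmin - κ₁)) + 2 * ((4 + κ₁) * (π * Real.sqrt 2) / (B.Dtmin - κ₁)) + π * Real.sqrt 2) * τ / 2) / 2 + κ₁ * (B.smax + κ₁ * (π * Real.sqrt 2 + 2 * B.smax) / (B.Dtmin - κ₁)) / 2 + 2 * (κ₁ *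 (π * Real.sqrt 2 + 2 * B.smax) / (B.Dtmin - κ₁)) + 2 * B.smax * (η₀ / B.Dtmin) + 2 * B.smax * (2 * κ₀ / B.Dtmin)) + τ / 2)) +
        κ₁ * ((((4 + κ₂) * (B.smax + κ₁ * (π * Real.sqrt 2 + 2 * B.smax) / (B.Dtmin - κ₁)) ^ 2 + (8 + 2 * κ₁) * ((4 + κ₁) * (π * Real.sqrt 2) / (B.Dtmin - κ₁)) + (4 + κ₁) * (π * Real.sqrt 2)) / (B.Dtmin - κ₁)) + 2 * ((4 + κ₁) * (π * Real.sqrt 2) / (B.Dtmin - κ₁)) + π * Real.sqrt 2) / 2 ≤ B.hmin / 2)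
    (hM : 0 < (2 * ((((4 + κ₂) * (B.smax + κ₁ * (π * Real.sqrt 2 + 2 * B.smax) / (B.Dtmin - κ₁)) ^ 2 + (8 + 2 * κ₁) * ((4 + κ₁) * (π * Real.sqrt 2) / (B.Dtmin - κ₁)) + (4 + κ₁) * (π * Real.sqrt 2)) / (B.Dtmin - κ₁)) + 2 * ((4 + κ₁) * (π * Real.sqrt 2) / (B.Dtmin - κ₁)) + π * Real.sqrt 2) + κ₁ * ((((4 + κ₂) * (B.smax + κ₁ * (π * Real.sqrt 2 + 2 * B.smax) / (B.Dtmin - κ₁)) ^ 2 + (8 + 2 * κ₁) * ((4 + κ₁) * (π * Real.sqrt 2) / (B.Dtmin - κ₁)) + (4 + κ₁) * (π * Real.sqrt 2)) / (B.Dtmin - κ₁)) + 2 * ((4 + κ₁) * (π * Real.sqrt 2) / (B.Dtmin - κ₁)) + π * Real.sqrt 2) / 2)) (hMG : 0 < (8 * (B.smax + κ₁ * (π * Real.sqrt 2 + 2 * B.smax) / (B.Dtmin - κ₁)) ^ 2 + 2 * (κ₂ * (B.smax + κ₁ * (π * Real.sqrt 2 + 2 * B.smax) / (B.Dtmin - κ₁))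 ^ 2) + 4 * ((((4 + κ₂) * (B.smax + κ₁ * (π * Real.sqrt 2 + 2 * B.smax) / (B.Dtmin - κ₁)) ^ 2 + (8 + 2 * κ₁) * ((4 + κ₁) * (π * Real.sqrt 2) / (B.Dtmin - κ₁)) + (4 + κ₁) * (π * Real.sqrt 2)) / (B.Dtmin - κ₁)) + 2 * ((4 + κ₁) * (π * Real.sqrt 2) / (B.Dtmin - κ₁)) + π * Real.sqrt 2) + κ₁ * ((((4 + κ₂) * (B.smax + κ₁ * (π * Real.sqrt 2 + 2 * B.smax) / (B.Dtmin - κ₁)) ^ 2 + (8 + 2 * κ₁) * ((4 + κ₁) * (π * Real.sqrt 2) / (B.Dtmin - κ₁)) + (4 + κ₁) * (π * Real.sqrt 2)) / (B.Dtmin - κ₁)) + 2 * ((4 + κ₁) * (π * Real.sqrt 2) / (B.Dtmin - κ₁)) + π * Real.sqrt 2))) :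
    ((((Finset.range ⌊τ / w⌋₊).filter fun i : ℕ =>
        |hfunE δ u μ P (σ - (w + i * w) / 2) (σ + (w + i * w) / 2)| ≤ δ' ∧
        |h3E δ u P (σ + (w + i * w) / 2) (σ - (w + i * w) / 2) + h3E δ u P (σ - (w + i * w) / 2) (σ + (w + i * w) / 2)| ≤ 2 * lam).card : ℝ)) ≤
      (⌊τ / w⌋₊ * w / min (η₀ / (2 * (2 * ((((4 + κ₂) * (B.smax + κ₁ * (π * Real.sqrt 2 + 2 * B.smax) / (B.Dtmin - κ₁)) ^ 2 + (8 + 2 * κ₁) * ((4 + κ₁) * (π * Real.sqrt 2) / (B.Dtmin - κ₁)) + (4 + κ₁) * (π * Real.sqrt 2)) / (B.Dtmin - κ₁)) + 2 * ((4 + κ₁) * (π * Real.sqrt 2) / (B.Dtmin - κ₁)) + π * Real.sqrt 2) + κ₁ * ((((4 + κ₂) * (B.smax + κ₁ * (π * Real.sqrt 2 + 2 * B.smax) / (B.Dtmin - κ₁)) ^ 2 + (8 + 2 * κ₁) * ((4 + κ₁) * (π * Real.sqrt 2) / (B.Dtmin - κ₁)) + (4 + κ₁) * (π * Real.sqrt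 2)) / (B.Dtmin - κ₁)) + 2 * ((4 + κ₁) * (π * Real.sqrt 2) / (B.Dtmin - κ₁)) + π * Real.sqrt 2) / 2) * τ)) (2 * lam / (8 * (B.smax + κ₁ * (π * Real.sqrt 2 + 2 * B.smax) / (B.Dtmin - κ₁)) ^ 2 + 2 * (κ₂ * (B.smax + κ₁ * (π * Real.sqrt 2 + 2 * B.smax) / (B.Dtmin - κ₁)) ^ 2) + 4 * ((((4 + κ₂) * (B.smax + κ₁ * (π * Real.sqrt 2 + 2 * B.smax) / (B.Dtmin - κ₁)) ^ 2 + (8 + 2 * κ₁) * ((4 + κ₁) * (π * Real.sqrt 2) / (B.Dtmin - κ₁)) + (4 + κ₁) * (π * Real.sqrt 2)) / (B.Dtmin - κ₁)) + 2 * ((4 + κ₁) * (π * Real.sqrt 2) / (B.Dtmin - κ₁)) + π * Real.sqrt 2) + κ₁ * ((((4 + κ₂) * (B.smax + κ₁ * (π * Real.sqrt 2 + 2 * B.smax) / (B.Dtmin - κ₁)) ^ 2 + (8 + 2 * κ₁) * ((4 + κ₁) * (π * Real.sqrt 2) / (B.Dtmin - κ₁)) + (4 + κ₁) * (π * Real.sqrt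 2)) / (B.Dtmin - κ₁)) + 2 * ((4 + κ₁) * (π * Real.sqrt 2) / (B.Dtmin - κ₁)) + π * Real.sqrt 2))) + 1) *
        (2 * ((if |hfunE δ u μ P σ σ| ≤ 2 * δ' then 2 * Real.sqrt (δ' / (B.hmin / 2))
          else 2 * δ' * Real.sqrt (2 * (2 * ((((4 + κ₂) * (B.smax + κ₁ * (π * Real.sqrt 2 + 2 * B.smax) / (B.Dtmin - κ₁)) ^ 2 + (8 + 2 * κ₁) * ((4 + κ₁) * (π * Real.sqrt 2) / (B.Dtmin - κ₁)) + (4 + κ₁) * (π * Real.sqrt 2)) / (B.Dtmin - κ₁)) + 2 * ((4 + κ₁) * (π * Real.sqrt 2) / (B.Dtmin - κ₁)) + π * Real.sqrt 2) + κ₁ * ((((4 + κ₂) * (B.smax + κ₁ * (π * Real.sqrt 2 + 2 * B.smax) / (B.Dtmin - κ₁)) ^ 2 + (8 + 2 * κ₁) * ((4 + κ₁) * (π * Real.sqrt 2) / (B.Dtmin - κ₁)) + (4 + κ₁) * (π * Real.sqrt 2)) / (B.Dtmin - κ₁)) + 2 * ((4 + κ₁) * (π * Real.sqrt 2) / (B.Dtmin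 - κ₁)) + π * Real.sqrt 2) / 2)) / (B.hmin / 2 * Real.sqrt |hfunE δ u μ P σ σ|)) / w + 1)) := by
  have hh := B.hmin_pos
  have h := gridCount_L5 (F := fun t => hfunE δ u μ P (σ - t / 2) (σ + t / 2))
    (F' := fun t => Real.sin (SXE u P (σ - t / 2) (σ + t / 2)) * (VXE u (σ + t / 2) - VXE u (σ - t / 2)) +
        Real.sin (SYE u P (σ - t / 2) (σ + t / 2)) * (VYE u (σ + t / 2) - VYE u (σ - t / 2)) +
        fderiv ℝ δ (momE u P (σ - t / 2) (σ + t / 2))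
          ![(VXE u (σ + t / 2) - VXE u (σ - t / 2)) / 2, (VYE u (σ + t / 2) - VYE u (σ - t / 2)) / 2])
    (G := fun t => h3E δ u P (σ + t / 2) (σ - t / 2) + h3E δ u P (σ - t / 2) (σ + t / 2))
    (hasDerivAt_hfunE_anti B hδs hδ hlo hhi hκ hκ₁ hu P σ)
    (M := (2 * ((((4 + κ₂) * (B.smax + κ₁ * (π * Real.sqrt 2 + 2 * B.smax) / (B.Dtmin - κ₁)) ^ 2 + (8 + 2 * κ₁) * ((4 + κ₁) * (π * Real.sqrt 2) / (B.Dtmin - κ₁)) + (4 + κ₁) * (π * Real.sqrt 2)) / (B.Dtmin - κ₁)) + 2 * ((4 + κ₁) * (π * Real.sqrt 2) / (B.Dtmin - κ₁)) + π * Real.sqrt 2) + κ₁ * ((((4 + κ₂) * (B.smax + κ₁ * (π * Real.sqrt 2 + 2 * B.smax) / (B.Dtmin - κ₁)) ^ 2 + (8 + 2 * κ₁) * ((4 + κ₁) * (π * Real.sqrt 2) / (B.Dtmin - κ₁)) + (4 + κ₁) * (π * Real.sqrt 2)) / (B.Dtmin - κ₁)) + 2 * ((4 + κ₁) * (π * Real.sqrt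 2) / (B.Dtmin - κ₁)) + π * Real.sqrt 2) / 2)) (MG := (8 * (B.smax + κ₁ * (π * Real.sqrt 2 + 2 * B.smax) / (B.Dtmin - κ₁)) ^ 2 + 2 * (κ₂ * (B.smax + κ₁ * (π * Real.sqrt 2 + 2 * B.smax) / (B.Dtmin - κ₁)) ^ 2) + 4 * ((((4 + κ₂) * (B.smax + κ₁ * (π * Real.sqrt 2 + 2 * B.smax) / (B.Dtmin - κ₁)) ^ 2 + (8 + 2 * κ₁) * ((4 + κ₁) * (π * Real.sqrt 2) / (B.Dtmin - κ₁)) + (4 + κ₁) * (π * Real.sqrt 2)) / (B.Dtmin - κ₁)) + 2 * ((4 + κ₁) * (π * Real.sqrt 2) / (B.Dtmin - κ₁)) + π * Real.sqrt 2) + κ₁ * ((((4 + κ₂) * (B.smax + κ₁ * (π * Real.sqrt 2 + 2 * B.smax) / (B.Dtmin - κ₁)) ^ 2 + (8 + 2 * κ₁) * ((4 + κ₁) * (π * Real.sqrt 2) / (B.Dtmin - κ₁)) + (4 + κ₁) * (π * Real.sqrt 2)) / (B.Dtmin - κ₁)) + 2 * ((4 + κ₁) * (π * Real.sqrt 2)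 / (B.Dtmin - κ₁)) + π * Real.sqrt 2))) (c := B.hmin / 2) (lam := lam) (η₀ := η₀) (τ := τ) (δ := δ')
    hM hMG (by positivity) hlam hτ hη₀ hδ'0 hδη
    (abs_anti_derivE_le B hδs hδ hlo hhi hκ hκ₁ hκ₂ hu P σ) (abs_G_sub_le B hδs hδ hlo hhi hκ hκ₁ hκ₂ hu P σ)
    (fun t ht0 htτ hF hG => anti_key_perturbed B hδs hδ hlo hhi hκ hκ₁ hκ₂ hu ht0 htτ hlo' hhi' hF hG hsmall)
    hw (K₀ := ⌊τ / w⌋₊) (by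
      have := Nat.floor_le (div_nonneg hτ.le hw.le) (a := τ / w)
      rwa [le_div_iff₀ hw] at this)
  simp only [zero_div, sub_zero, add_zero] at h
  exact h

end FoldCounts

end Summit.HubbardSuperconductivity.HubbardSuperconductivity.Theorems.PerturbedFermiCurve

end
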